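import Summits.HodgeConjecture.HodgeConjecture.Theorems.CYFormCasimirCYFormSquarePrincipleInvariantForms
import Literature.AlgebraicGeometry.Deligne1982.HodgeGroupInvariantClasses
import Literature.AlgebraicGeometry.HodgeTheory.HodgeTypeOfFlatSections
import HarnessLib

/-!
# Crux X3 `CYFormSquarePrinciple` (route `CYFormCasimir`, stmt-HodgeConjecture-23494), helper file 4a:
# the CY form `T ⊂ H⁴(A(ℂ); ℂ)` and its `K`-conjugate `(𝟙 + 2φ)^* T` decompose `⋀⁴W ⊕ ⋀⁴W^*`

research route conditional on HC_CM; not a corollary. Nothing here proves HC, HC_CM or any rung.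

Setting of the crux (van Geemen–Rapagnetta, arXiv:2607.18341 §1.15; Friedman–Laza §2.4.2): `A` an
abelian eightfold, `φ ≫ φ = -d`, and `T ⊂ H⁴(A(ℂ); ℂ)` a sub-`ℂ`-space with `T ≤ ⋀⁴W ⊕ ⋀⁴W^*`
(`weilClassesPlus/Minus A φ 2 d`), `T ∩ ⋀⁴W = 0`, `dim T = 70`, spanned by rational classes (`hTrat`) and
by its pure-type classes (`hThs`) — i.e. `T` is (the complexification of) a sub-Hodge structure. Proved here:

* Galois descent on the carriers: a class fixed by all coefficient twists `σ_*`, `σ ∈ Aut(ℂ)`, is rational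
  (`isRationalClass_of_forall_coeffClass_eq`; Deligne LNM 900 I §3, Borel AG 14.2);
* `T` is stable under complex conjugation, under the `σ_*`, and under the Hodge type projectors
  (`conjClass_mem_of_mem`, `coeffClass_mem_of_mem`, `typeProj_mem_of_mem`);
* `T ∩ ⋀⁴W^* = 0` (conjugation swaps `⋀⁴W`, `⋀⁴W^*`), `T ∩ Ψ T = 0` and `T ⊕ Ψ T = ⋀⁴W ⊕ ⋀⁴W^*` for the test
  pull-back `Ψ = (𝟙 + 2φ)^*`, which acts by `(1+2i√d)⁴ ≠ (1-2i√d)⁴` on the two summands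
  (`inf_weilClassesMinus_eq_bot`, `inf_map_testOp_eq_bot`, `sup_map_testOp_eq`): `T` is the graph of an
  isomorphism `⋀⁴W^* ⥲ ⋀⁴W` and `Ψ T` the graph of a different multiple of it.

References: Deligne1982HodgeCycles (I §3), vanGeemen1994HodgeAV (4.9, proof of Thm. 6.12), FriedmanLaza2013
(§3.5 Prop. 37), vanGeemenRapagnetta2026WeilHK (§1.15), Borel1991 (AG §14.2).
-/

-- `Summit.HodgeConjecture.HodgeConjecture.…` is the tree's mandated summit/problem namespace (single-problem summit).
set_option linter.dupNamespace false
noncomputable section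

open CategoryTheory Cardinal
open scoped TensorProduct
open Literature.AlgebraicTopology.SingularHomology
open Literature.AlgebraicGeometry.Motives
open Literature.AlgebraicGeometry.HodgeTheory
open Literature.AlgebraicGeometry.VanGeemen1994

namespace Summit.HodgeConjecture.HodgeConjecture.Theorems.CYFormSquare

/-! ### Galois descent: classes fixed by all coefficient twists are rational -/

/-- **A class of `Hᵏ(X(ℂ); ℂ)` fixed by every coefficient twist `σ_*`, `σ ∈ Aut(ℂ)`, is rational** (`X`
smooth projective): in a rational basis its coordinates are fixed by `Aut(ℂ)`, hence rational (the fixed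
field of `Aut(ℂ)` is `ℚ`, the tree's `Complex.mem_subfield_of_forall_ringEquiv`).
[cite: Deligne1982HodgeCycles, I §3, proof of Prop. 3.4] [cite: Borel1991, AG §14.2] -/
theorem isRationalClass_of_forall_coeffClass_eq {n : ℕ} {X : SchemeOver ℂ} (hX : IsSmoothProjective n X)
    {k : ℕ} {c : complexBetti X k}
    (hc : ∀ σ : ℂ ≃+* ℂ, coeffClass (R := ℂ) (S := ℂ) σ.toRingHom.toAddMonoidHom k c = c) :
    IsRationalClass c := by
  classical
  haveI : Module.Finite ℚ (bettiCohomology X k) := finite_singularCohomology_rat_complexPoints hX k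
  set β := ofRatClassBaseChangeEquiv hX k with hβdef
  set dd := Module.finrank ℚ (bettiCohomology X k) with hdd
  let b : Module.Basis (Fin dd) ℚ (bettiCohomology X k) := Module.finBasis ℚ (bettiCohomology X k)
  let Bc : Module.Basis (Fin dd) ℂ (ℂ ⊗[ℚ] bettiCohomology X k) := Algebra.TensorProduct.basis ℂ b
  let B : Module.Basis (Fin dd) ℂ (complexBetti X k) := Bc.map β
  have hBc : ∀ i, Bc i = (1 : ℂ) ⊗ₜ b i := fun i ↦ Algebra.TensorProduct.basis_apply b i
  have hB : ∀ i, B i = ofRatClass (ComplexPoints X) k (b i) := fun i ↦ by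
    change β (Bc i) = _
    rw [hBc, hβdef, ofRatClassBaseChangeEquiv_apply, ofRatClassBaseChange_tmul, one_smul]
  have hBrat : ∀ i, IsRationalClass (B i) := fun i ↦ by rw [hB]; exact isRationalClass_ofRatClass _
  -- the coordinates of `c` are fixed by every `σ`
  have hfix : ∀ (σ : ℂ ≃+* ℂ) (i : Fin dd), σ (B.repr c i) = B.repr c i := by
    intro σ i
    have htw : coeffClass (R := ℂ) (S := ℂ) σ.toRingHom.toAddMonoidHom k c = ∑ j, σ (B.repr c j) • B j := by
      conv_lhs => rw [← B.sum_repr c]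
      rw [map_sum]
      exact Finset.sum_congr rfl fun j _ ↦ by
        rw [coeffClass_ringHom_smul, (hBrat j).coeffClass_ringHom_eq σ.toRingHom]; rfl
    rw [hc σ] at htw
    have h := congrArg (fun z ↦ B.repr z i) htw
    simp only [map_sum, map_smul, B.repr_self, Finsupp.smul_single, smul_eq_mul, mul_one, Finset.sum_apply',
      Finsupp.single_apply, Finset.sum_ite_eq', Finset.mem_univ, if_true] at h
    exact h.symm
  -- hence rational
  set F : Subfield ℂ := (Rat.castHom ℂ).fieldRange with hF
  have hFcount : #F ≤ ℵ₀ := by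
    rw [Cardinal.mk_le_aleph0_iff, hF]
    exact (Set.countable_range (Rat.castHom ℂ)).to_subtype
  have hq : ∀ i, ∃ q : ℚ, (q : ℂ) = B.repr c i := fun i ↦ by
    have hmem : B.repr c i ∈ F :=
      Literature.FieldTheory.AlgClosed.Complex.mem_subfield_of_forall_ringEquiv F hFcount fun σ _ ↦ hfix σ i
    obtain ⟨q, hq⟩ := RingHom.mem_fieldRange.1 (hF ▸ hmem)
    exact ⟨q, hq⟩
  choose q hq using hq
  have e : c = ofRatClass (ComplexPoints X) k (∑ i, q i • b i) := by
    conv_lhs => rw [← B.sum_repr c]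
    rw [map_sum]
    exact Finset.sum_congr rfl fun i _ ↦ by rw [ofRatClass_smul, hq, hB]
  rw [e]
  exact isRationalClass_ofRatClass _

/-! ### Stability of a rationally spanned, type-spanned subspace -/

section Stable

variable {A : AbelianVariety ℂ} {T : Submodule ℂ (complexBetti A.X (2 * 2))}

/-- A subspace spanned by its rational classes is stable under complex conjugation. [cite: VoisinHodgeI2002, Cor. 6.12] -/
theorem conjClass_mem_of_mem (hTrat : T ≤ Submodule.span ℂ {c | c ∈ T ∧ IsRationalClass c})
    {t : complexBetti A.X (2 * 2)} (ht : t ∈ T) : conjClass (ComplexPoints A.X) (2 * 2) t ∈ T := by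
  have h := hTrat ht
  clear ht
  induction h using Submodule.span_induction with
  | mem x hx => rw [hx.2.conjClass_eq]; exact hx.1
  | zero => rw [conjClass_zero]; exact T.zero_mem
  | add x y _ _ hx hy => rw [conjClass_add]; exact T.add_mem hx hy
  | smul a x _ hx => rw [conjClass_smul]; exact T.smul_mem _ hx

/-- A subspace spanned by its rational classes is stable under every coefficient twist `σ_*`.
[cite: Deligne1982HodgeCycles, I §3] -/
theorem coeffClass_mem_of_mem (hTrat : T ≤ Submodule.span ℂ {c | c ∈ T ∧ IsRationalClass c}) (σ : ℂ ≃+* ℂ)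
    {t : complexBetti A.X (2 * 2)} (ht : t ∈ T) :
    coeffClass (R := ℂ) (S := ℂ) σ.toRingHom.toAddMonoidHom (2 * 2) t ∈ T := by
  have h := hTrat ht
  clear ht
  induction h using Submodule.span_induction with
  | mem x hx => rw [hx.2.coeffClass_ringHom_eq]; exact hx.1
  | zero => rw [map_zero]; exact T.zero_mem
  | add x y _ _ hx hy => rw [map_add]; exact T.add_mem hx hy
  | smul a x _ hx => rw [coeffClass_ringHom_smul]; exact T.smul_mem _ hx

/-- A subspace spanned by its pure-type classes is stable under the Hodge type projectors.
[cite: VoisinHodgeI2002, §7.1.1] -/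
theorem typeProj_mem_of_mem (hA : A.dim = 2 * 4) (M : HodgeModel (2 * 4) A.X)
    (hThs : T ≤ Submodule.span ℂ {c | c ∈ T ∧ ∃ p q : ℕ, p + q = 4 ∧ IsOfHodgeType (2 * 4) A.X (2 * 2) p q c})
    (pq : ↥(Finset.HasAntidiagonal.antidiagonal (2 * 2))) {t : complexBetti A.X (2 * 2)} (ht : t ∈ T) :
    M.typeProj (2 * 2) pq t ∈ T := by
  classical
  have hX : IsSmoothProjective (2 * 4) A.X := isSmoothProjective_of_dim_eq' hA
  have h := hThs ht
  clear ht
  induction h using Submodule.span_induction with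
  | mem x hx =>
    obtain ⟨hxT, p, q, hpq, hx⟩ := hx
    set pq' : ↥(Finset.HasAntidiagonal.antidiagonal (2 * 2)) :=
      ⟨(p, q), Finset.HasAntidiagonal.mem_antidiagonal.2 (by omega)⟩ with hpq'
    have hmem : x ∈ M.typePiece (2 * 2) pq' := (M.mem_typePiece_iff_isOfHodgeType' hX pq' x).2 hx
    by_cases h : pq' = pq
    · rw [← h, M.typeProj_apply_of_mem hmem]; exact hxT
    · rw [M.typeProj_apply_of_mem_ne h hmem]; exact T.zero_mem
  | zero => rw [map_zero]; exact T.zero_mem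
  | add x y _ _ hx hy => rw [map_add]; exact T.add_mem hx hy
  | smul a x _ hx => rw [map_smul]; exact T.smul_mem _ hx

end Stable

/-! ### `T` against `⋀⁴W^*` and against its `K`-conjugate `(𝟙 + 2φ)^* T` -/

section Graph

variable {A : AbelianVariety ℂ} {d : ℕ} {φ : A ⟶ A}
variable (hn : 2 ≤ 4) (hd : 0 < d) (hA : A.dim = 2 * 4) (hφ : φ ≫ φ = -(d • 𝟙 A))
  (e : ProjectiveEmbedding A.X) {a : complexBetti (projectiveSpace e.n ℂ) 2} (ha : IsRationalClass a)
  (ha0 : a ≠ 0)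
  {T : Submodule ℂ (complexBetti A.X (2 * 2))}
  (hTle : T ≤ weilClassesPlus A φ 2 d ⊔ weilClassesMinus A φ 2 d)
  (hT0 : T ⊓ weilClassesPlus A φ 2 d = ⊥)
  (hT70 : Module.finrank ℂ T = 70)
  (hTrat : T ≤ Submodule.span ℂ {c | c ∈ T ∧ IsRationalClass c})

include hTrat hT0 in
/-- **`T ∩ ⋀⁴W^* = 0`**: complex conjugation preserves `T` (rationally spanned) and maps `⋀⁴W^*` into `⋀⁴W`
(`conjClass_mem_weilClassesPlus`), which meets `T` trivially. [cite: vanGeemen1994HodgeAV, proof of Lemma 5.2 (6)] -/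
theorem inf_weilClassesMinus_eq_bot : T ⊓ weilClassesMinus A φ 2 d = ⊥ := by
  rw [Submodule.eq_bot_iff]
  rintro c ⟨hcT, hcM⟩
  have h1 : conjClass (ComplexPoints A.X) (2 * 2) c ∈ T ⊓ weilClassesPlus A φ 2 d :=
    ⟨conjClass_mem_of_mem hTrat hcT, conjClass_mem_weilClassesPlus hcM⟩
  rw [hT0, Submodule.mem_bot] at h1
  rw [← conjClass_conjClass c, h1, conjClass_zero]

/-- The eigenvalues of `Ψ = (𝟙 + 2φ)^*` on `⋀⁴W` and `⋀⁴W^*` differ: `(1+2i√d)⁴ ≠ (1-2i√d)⁴`.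
[cite: vanGeemen1994HodgeAV, proof of Thm. 6.12] -/
theorem testChar_plus_ne_minus (hd : 0 < d) :
    ((((1 : ℕ) : ℂ) + ((2 : ℕ) : ℂ) * Complex.I * (Real.sqrt d : ℂ)) ^ (2 * 2)) ≠
      ((((1 : ℕ) : ℂ) - ((2 : ℕ) : ℂ) * Complex.I * (Real.sqrt d : ℂ)) ^ (2 * 2)) := by
  push_cast
  exact one_add_pow_ne_one_sub_pow hd (m := 2 * 2) (by norm_num) (by norm_num)

include hTle in
/-- `Ψ = (𝟙 + 2φ)^*` on `T ≤ ⋀⁴W ⊕ ⋀⁴W^*`: `Ψ(x + y) = ε₊ x + ε₋ y`. [cite: vanGeemen1994HodgeAV, 4.9] -/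
theorem testOp_apply_of_mem {t : complexBetti A.X (2 * 2)} (ht : t ∈ T) :
    ∃ x ∈ weilClassesPlus A φ 2 d, ∃ y ∈ weilClassesMinus A φ 2 d, t = x + y ∧
      complexBetti.map ((1 : ℕ) • 𝟙 A + (2 : ℕ) • φ).hom.hom.hom (2 * 2) t =
        ((((1 : ℕ) : ℂ) + ((2 : ℕ) : ℂ) * Complex.I * (Real.sqrt d : ℂ)) ^ (2 * 2)) • x +
          ((((1 : ℕ) : ℂ) - ((2 : ℕ) : ℂ) * Complex.I * (Real.sqrt d : ℂ)) ^ (2 * 2)) • y := by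
  obtain ⟨x, hx, y, hy, hxy⟩ := Submodule.mem_sup.1 (hTle ht)
  refine ⟨x, hx, y, hy, hxy.symm, ?_⟩
  rw [← hxy, map_add]
  exact congrArg₂ (· + ·) ((mem_weilClassesPlus_iff.1 hx) 1 2) ((mem_weilClassesMinus_iff.1 hy) 1 2)

include hd hTle hT0 hTrat in
/-- **`T ∩ Ψ T = 0`** for `Ψ = (𝟙 + 2φ)^*`: if `t = Ψ t'` with `t, t' ∈ T`, `t' = x + y`, then
`ε₋ t' - t = (ε₋ - ε₊) x ∈ T ∩ ⋀⁴W = 0`, so `x = 0` and `t' ∈ T ∩ ⋀⁴W^* = 0`. [cite: FriedmanLaza2013, §3.5 Prop. 37] -/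
theorem inf_map_testOp_eq_bot :
    T ⊓ T.map (complexBetti.map ((1 : ℕ) • 𝟙 A + (2 : ℕ) • φ).hom.hom.hom (2 * 2)).hom = ⊥ := by
  set εp : ℂ := (((1 : ℕ) : ℂ) + ((2 : ℕ) : ℂ) * Complex.I * (Real.sqrt d : ℂ)) ^ (2 * 2) with hεp
  set εm : ℂ := (((1 : ℕ) : ℂ) - ((2 : ℕ) : ℂ) * Complex.I * (Real.sqrt d : ℂ)) ^ (2 * 2) with hεm
  rw [Submodule.eq_bot_iff]
  rintro t ⟨ht, ht'⟩
  obtain ⟨t₀, ht₀, rfl⟩ := Submodule.mem_map.1 ht'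
  obtain ⟨x, hx, y, hy, hxy, hΨ⟩ := testOp_apply_of_mem hTle ht₀
  change complexBetti.map ((1 : ℕ) • 𝟙 A + (2 : ℕ) • φ).hom.hom.hom (2 * 2) t₀ ∈ T at ht
  rw [hΨ] at ht ⊢
  -- `(εm - εp) • x ∈ T ⊓ ⋀⁴W = 0`
  have h1 : (εm - εp) • x ∈ T ⊓ weilClassesPlus A φ 2 d := by
    refine ⟨?_, Submodule.smul_mem _ _ hx⟩
    have h := T.sub_mem (T.smul_mem εm ht₀) ht
    rw [hxy] at h
    have e : εm • (x + y) - (εp • x + εm • y) = (εm - εp) • x := by module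
    rwa [e] at h
  rw [hT0, Submodule.mem_bot] at h1
  have hx0 : x = 0 := by
    rcases smul_eq_zero.1 h1 with h | h
    · exact absurd (sub_eq_zero.1 h).symm (testChar_plus_ne_minus hd)
    · exact h
  -- then `t₀ = y ∈ T ⊓ ⋀⁴W^* = 0`
  have hy0 : y = 0 := by
    have h2 : y ∈ T ⊓ weilClassesMinus A φ 2 d := ⟨by rw [hxy, hx0, zero_add] at ht₀; exact ht₀, hy⟩
    rw [inf_weilClassesMinus_eq_bot hT0 hTrat, Submodule.mem_bot] at h2
    exact h2
  rw [hx0, hy0, smul_zero, smul_zero, add_zero]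

include hd hTle in
/-- `Ψ = (𝟙 + 2φ)^*` is injective on `T ≤ ⋀⁴W ⊕ ⋀⁴W^*` (it acts by the non-zero scalars `ε₊`, `ε₋` on the
two disjoint summands). [cite: vanGeemen1994HodgeAV, 4.9] -/
theorem testOp_injOn {t : complexBetti A.X (2 * 2)} (ht : t ∈ T)
    (h0 : complexBetti.map ((1 : ℕ) • 𝟙 A + (2 : ℕ) • φ).hom.hom.hom (2 * 2) t = 0) : t = 0 := by
  obtain ⟨x, hx, y, hy, hxy, hΨ⟩ := testOp_apply_of_mem hTle ht
  rw [h0] at hΨ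
  have hdisj := disjoint_weilClassesPlus_weilClassesMinus A φ (n := 2) (d := d) (by norm_num) hd
  rw [Submodule.disjoint_def] at hdisj
  have hα : (((1 : ℕ) : ℂ) + ((2 : ℕ) : ℂ) * Complex.I * (Real.sqrt d : ℂ)) ^ (2 * 2) ≠ 0 := by
    push_cast; exact pow_ne_zero _ (one_add_two_I_sqrt_ne_zero d)
  have hβ : (((1 : ℕ) : ℂ) - ((2 : ℕ) : ℂ) * Complex.I * (Real.sqrt d : ℂ)) ^ (2 * 2) ≠ 0 := by
    push_cast; exact pow_ne_zero _ (one_sub_two_I_sqrt_ne_zero d)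
  -- `ε₊ x = -ε₋ y ∈ ⋀⁴W ∩ ⋀⁴W^* = 0`
  have hx' : (((1 : ℕ) : ℂ) + ((2 : ℕ) : ℂ) * Complex.I * (Real.sqrt d : ℂ)) ^ (2 * 2) • x = 0 := by
    refine hdisj _ (Submodule.smul_mem _ _ hx) ?_
    have e : (((1 : ℕ) : ℂ) + ((2 : ℕ) : ℂ) * Complex.I * (Real.sqrt d : ℂ)) ^ (2 * 2) • x =
        -((((1 : ℕ) : ℂ) - ((2 : ℕ) : ℂ) * Complex.I * (Real.sqrt d : ℂ)) ^ (2 * 2) • y) :=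
      eq_neg_of_add_eq_zero_left hΨ.symm
    rw [e]; exact Submodule.neg_mem _ (Submodule.smul_mem _ _ hy)
  have hx0 : x = 0 := (smul_eq_zero.1 hx').resolve_left hα
  rw [hx0, smul_zero, zero_add] at hΨ
  have hy0 : y = 0 := (smul_eq_zero.1 hΨ.symm).resolve_left hβ
  rw [hxy, hx0, hy0, add_zero]

include hd hTle hT70 in
/-- `dim Ψ T = dim T = 70`. [cite: FriedmanLaza2013, §3.5 Prop. 37] -/
theorem finrank_map_testOp :
    Module.finrank ℂ (T.map (complexBetti.map ((1 : ℕ) • 𝟙 A + (2 : ℕ) • φ).hom.hom.hom (2 * 2)).hom) = 70 := by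
  set Ψ := (complexBetti.map ((1 : ℕ) • 𝟙 A + (2 : ℕ) • φ).hom.hom.hom (2 * 2)).hom with hΨ
  have hinj : Function.Injective (Ψ ∘ₗ T.subtype) := by
    rw [← LinearMap.ker_eq_bot, Submodule.eq_bot_iff]
    intro t ht
    rw [LinearMap.mem_ker, LinearMap.comp_apply, Submodule.subtype_apply] at ht
    exact Subtype.ext (testOp_injOn hd hTle t.2 ht)
  rw [← Submodule.range_subtype T, ← LinearMap.range_comp, LinearMap.finrank_range_of_inj hinj, hT70]

include hn hd hA hφ e ha ha0 hTle hT0 hT70 hTrat in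
/-- **`T ⊕ Ψ T = ⋀⁴W ⊕ ⋀⁴W^*`** (`Ψ = (𝟙 + 2φ)^*`): both sides have dimension `140 = 2 · C(8,4)`, the left by
`T ∩ Ψ T = 0`, the right by `dim ⋀⁴W, dim ⋀⁴W^* ≤ 70`. [cite: FriedmanLaza2013, §3.5 Prop. 37 (iv)] -/
theorem sup_map_testOp_eq :
    T ⊔ T.map (complexBetti.map ((1 : ℕ) • 𝟙 A + (2 : ℕ) • φ).hom.hom.hom (2 * 2)).hom =
      weilClassesPlus A φ 2 d ⊔ weilClassesMinus A φ 2 d := by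
  haveI := finite_complexBetti_abelianVariety A (2 * 2)
  set Ψ := (complexBetti.map ((1 : ℕ) • 𝟙 A + (2 : ℕ) • φ).hom.hom.hom (2 * 2)).hom with hΨ
  have hle : T ⊔ T.map Ψ ≤ weilClassesPlus A φ 2 d ⊔ weilClassesMinus A φ 2 d := by
    refine sup_le hTle ?_
    rw [Submodule.map_le_iff_le_comap]
    intro t ht
    obtain ⟨x, hx, y, hy, -, hΨt⟩ := testOp_apply_of_mem hTle ht
    rw [Submodule.mem_comap, hΨ]
    change complexBetti.map ((1 : ℕ) • 𝟙 A + (2 : ℕ) • φ).hom.hom.hom (2 * 2) t ∈ _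
    rw [hΨt]
    exact Submodule.add_mem _ (Submodule.mem_sup_left (Submodule.smul_mem _ _ hx))
      (Submodule.mem_sup_right (Submodule.smul_mem _ _ hy))
  refine Submodule.eq_of_le_of_finrank_le hle ?_
  have h1 := Submodule.finrank_sup_add_finrank_inf_eq T (T.map Ψ)
  rw [inf_map_testOp_eq_bot hd hTle hT0 hTrat, finrank_bot, add_zero, hT70, finrank_map_testOp hd hTle hT70] at h1
  have h2 := Submodule.finrank_add_le_finrank_add_finrank (weilClassesPlus A φ 2 d) (weilClassesMinus A φ 2 d)
  have h3 := finrank_weilClassesPlus_two_le hn hd hA hφ e ha ha0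
  have h4 := finrank_weilClassesMinus_two_le hn hd hA hφ e ha ha0
  omega

end Graph

end Summit.HodgeConjecture.HodgeConjecture.Theorems.CYFormSquare

end
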